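import Literature.Barriers.Parity.SiegelZeroDichotomyPairHLProp81Final3
import Literature.Barriers.Parity.SiegelZeroDichotomyPairHLKernelRefined
import Literature.Barriers.Parity.SiegelZeroDichotomyPairHLKernelAsymptotic
import Literature.Barriers.Parity.SiegelZeroDichotomyInputs
import HarnessLib
import Summits.Parity.GeneralizedHardyLittlewood.Theorems.UnboundedSiegelZeros

/-!
# `SiegelZeroTwinPrimes` discharged: Heath-Brown's dichotomy (unbounded Siegel zeros ⇒ twin primes)

Topic `Literature/Barriers/Parity`; sibling of the catalogue entry `SiegelZeroDichotomy.lean` (named fact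
`Literature.Barriers.Parity.SiegelZeroTwinPrimes := UnboundedSiegelZeros → TwinPrimeConjecture`), kept
separate because the proof imports the whole Tao–Teräväinen `…PairHL*` chain, which itself imports the
statement file. Everything here is a PROVED theorem; no definitions, no named facts.

Source: T. Tao, J. Teräväinen, *The Hardy–Littlewood–Chowla conjecture in the presence of a Siegel zero*,
J. London Math. Soc. (2) 106 (2022) 3317–3378, arXiv:2109.06291: Theorem 1.6 at `k = 2`, `ℓ = 0`
(= Corollary 1.8 (i)) "follows immediately from concatenating together Propositions 4.2, 5.2, 6.3, 7.2,
8.1" (§8, first paragraph); here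

* `TaoTeravainen2021_prop72_81_pair_holds` — Propositions 7.2 + 8.1 at `k = 2` (the named fact
  `TaoTeravainen2021_prop72_81_pair` of `…PairHLSiegelModel.lean`), from the assembly
  `prop72_81_pair_of_kernelBounds` (`…PairHLProp81Final3.lean`: §7 = Propositions 7.1/7.2 and the §8
  reductions (8.5)–(8.19), all proved in the `…PairHL*` files) and the two Euler-product bounds for its
  kernel, `kernel_KB2` ((8.20), `…PairHLKernelRefined.lean`) and `kernel_KB3` ((8.21)–(8.25),
  `…PairHLKernelAsymptotic.lean`, using Corollary 3.6 `TaoTeravainen2021_cor36_i_holds`);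
* `TaoTeravainen2021_pairHL_holds` — Corollary 1.8 (i) (the named fact of `…PairHL.lean`), by
  `TaoTeravainen2021_pairHL_of_prop72_81_pair` (Proposition 5.2 being `TaoTeravainen2021_prop52_pair_holds`);
* **`SiegelZeroTwinPrimes_holds`** — the catalogue fact, by `SiegelZeroTwinPrimes_of_prop72_81_pair`
  (`SiegelZeroDichotomyInputs.lean`; Theorem 1.5 (i) / Corollary 1.8 (i) at the shifts `(1, 3)`).
  [cite: TaoTeravainen2021, Theorem 1.5 (i), Theorem 1.6, Corollary 1.8 (i), §8 (first paragraph)]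

## References

* T. Tao, J. Teräväinen, *The Hardy–Littlewood–Chowla conjecture in the presence of a Siegel zero*,
  J. London Math. Soc. (2) 106 (2022), 3317–3378, arXiv:2109.06291. [TaoTeravainen2021]
* D. R. Heath-Brown, *Prime twins and Siegel zeros*, Proc. London Math. Soc. (3) 47 (1983), 193–224
  (the original dichotomy, Theorem 1.5 (i) of the source above).
-/

noncomputable section

namespace Literature.Barriers.Parity

/-- **Tao–Teräväinen, Propositions 7.2 + 8.1 at `k = 2`, `ℓ = 0`, PROVED**: the discharge of the named
fact `TaoTeravainen2021_prop72_81_pair` — the assembly `prop72_81_pair_of_kernelBounds` fed with the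
refined bound (8.20) (`kernel_KB2`) and the asymptotic (8.25) (`kernel_KB3`) for the Euler product of its
kernel. [cite: TaoTeravainen2021, Propositions 7.2 and 8.1, §8 (8.20)–(8.25)] -/
theorem TaoTeravainen2021_prop72_81_pair_holds : TaoTeravainen2021_prop72_81_pair :=
  TaoTeravainen.prop72_81_pair_of_kernelBounds TaoTeravainen.kernel_KB2 TaoTeravainen.kernel_KB3

/-- **Tao–Teräväinen, Corollary 1.8 (i), PROVED** (Theorem 1.6 at `k = 2`, `ℓ = 0`: the Hardy–Littlewood
pair asymptotic with error `O(1/log^{1/20} η)` in the presence of a Siegel zero of quality `η`).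
[cite: TaoTeravainen2021, Corollary 1.8 (i) and §8 (first paragraph)] -/
theorem TaoTeravainen2021_pairHL_holds : TaoTeravainen2021_pairHL :=
  TaoTeravainen2021_pairHL_of_prop72_81_pair TaoTeravainen2021_prop72_81_pair_holds

/-- **Heath-Brown 1983 / Tao–Teräväinen 2022, the dichotomy PROVED**: Siegel zeros of unbounded quality
at arbitrarily large conductors imply the twin prime conjecture — the discharge of the catalogue fact
`Literature.Barriers.Parity.SiegelZeroTwinPrimes`.
[cite: TaoTeravainen2021, Theorem 1.5 (i) and Corollary 1.8 (i)] -/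
theorem SiegelZeroTwinPrimes_holds : SiegelZeroTwinPrimes :=
  SiegelZeroTwinPrimes_of_prop72_81_pair TaoTeravainen2021_prop72_81_pair_holds

/-- The no-go in final form: if the twin prime conjecture fails, then from some conductor on every Siegel
zero has bounded quality (`¬ UnboundedSiegelZeros`). [cite: TaoTeravainen2021, Corollary 1.8 (i) and (1.4)] -/
theorem not_unboundedSiegelZeros_of_not_twinPrimes
    (h : ¬Literature.NumberTheory.Sieve.TwinPrimeConjecture) : ¬Summit.Parity.GeneralizedHardyLittlewood.UnboundedSiegelZeros :=
  fun hU => h (SiegelZeroTwinPrimes_holds hU)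

end Literature.Barriers.Parity
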